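import Summits.QuantumFields.YangMills.Theorems.BalabanUVNodesN07KnitTokensLandauTwoOfEq81
import Summits.QuantumFields.YangMills.Theorems.BalabanUVNodesN07Eq81OfEq26AtRecord
import HarnessLib

/-!
# N07 ∕ K0ᴬ at `N = 2` — THE KNIT CHAIN FOR def-Y's CURRENT SCHEME, CLOSED UP TO NAMED ROWS: (rng) ∧ (star_mem) ∧ (min) ∧ (c→s) for the Landau family at the (47)-carrying chart
# `𝔖♭.chartLin T♭`, from the road's standard rows + numerics + `HessSymmTok` + `Delta2Tok` + reality rows + `RD*𝔄V = 0` + THE F-H ROW «`RD*(H₁♭D(A′)) = 0` on the Landau ball» — NO expansion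
# identity displayed any more ((26), (74)⟹(81), (81)⟹(84), (84)+(110)⟹tokens are all theorems of this lineage: LANDED-1…9)

Cell `pub-ymgap`, seat `pub-ymgap-dag-n07-w3` (g29, WIDTH SEAT 3 on N07 [B11] = [15]); helper file keyed `--kind proof --supports stmt-QuantumFields-27238 --as helper` (K0ᴬ road);
count-neutral.  INTENT-10 of the seat.

## What is here

* §0 (any `N`) `piOfRecord_iota_of_landau` (`π` fixes the LANDAU KERNEL `RD*X = 0`, read on `L²` — the correct row for `A′`-side objects, which live on the AFFINE slice (77)∩(76), not in
  (102) = `ker Q ⊓ ker RD*`: RR-2 READ 23), `landau_of_mem_constraint102`, ★★★ `eq81_of_eq26_along_chart_of_landau` (LANDED-9's regrouping with the `π`-rows typed as Landau rows — the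
  correctly typed companion of ✓`eq81_of_eq26_along_chart_of_mem`, whose (102)-memberships force `B = 0` ∕ `D(A′) = 0`).
* §1 ★ `row84_of_eq81_slice` (any `N`, any slot `T`) — ✓`N07Row84OfEq81AtRecord.row84_of_eq81` with its VALUE row asked only on `evHerm0 ∩ {RD*A′ = 0}` (where (81) with `Δ₁ = π†(Δ+Δ⁽²⁾)π` is
  print's — off the Landau kernel `π` acts), at the price of the displayed row `RD*𝔄V = 0` (so the lines `A′ + tδ` stay in the kernel).
* §2 ★★★ `knitTokens_landau_two_of_rows` (N = 2) — ✓`knitTokens_landau_two_of_row84` (LANDED-4) ∘ §1 ∘ ✓`eq81_of_eq26_along_chart_of_mem` (LANDED-9) at `H := H₁♭`, `C := C^{sl}`,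
  `a₀ := A^η(U₀)`, `c := N⁻¹`: the four tokens, displayed rows = file 4's (Sect. C, standard, numerics) + `HessSymmTok F 2 K k U₀ Δ2` + `Delta2Tok F 2 K k Ω U₀ levB a hposb hQ Δ2` (def-Y's
  tokens VERBATIM) + reality∕trace of `T47 A′` on the Landau ball (this lineage ✓`conjJet_T47_eq`, ✓`trace_equiv_T47_eq_zero` under the section's rows) + `RD*𝔄V = 0` (print's (45) 2nd row for
  the slot-(c) `H₁ = H1OfRecordAtBg128 … G′ Δ⁽²⁾ …` — def-Y token wanted, RR-2: «`H1LandauTok`») + **THE F-H ROW** «`∀ A′ ∈ evHerm0, RD*A′ = 0, ‖A′‖ < ρ₀ → RD*(Emap H₁♭ C^{sl} ε_C A′) = 0`».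

## Honest labels

**THE F-H ROW IS NOT A THEOREM FOR `H₁♭` OFF CRITICALITY** (RR-2's TRACE FLAG F-H, 2026-08-31: `H₁♭ = H1OfRecordAtBgFlat` is the `G₀`-slot right inverse, `RD*H₁♭ ≠ 0` when `J(U₀) ≠ 0`); so at
a generic guarded background §2 is VACUOUS (its F-H hypothesis uninhabitable) — by design: it records EXACTLY what def-Y's current `T♭`∕`WOfRecordAt` scheme needs, and becomes print's
statement under the substitution `H₁♭ ↦ H_π := H1OfRecordAtBg128 … G′ 0 a hpos₀ hQ` (def-Y's F-H re-key), for which the row is def-Y's `FrakGSliceTok … G′ 0 …`.  Nothing of Bałaban's estimates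
proved; K0ᴬ ⟨27238⟩ NOT closed; N07 NOT discharged; COUNT∕K UNMOVED; R4 is the conditional finite-𝕋⁴ rung `BalabanLadder.UV` only; finite torus at fixed `ε` — nothing continuum ∕ OS ∕ Clay.
**The Yang–Mills mass gap is NOT proved by any of this.**  No `sorry`, no `def`, no `instance ∕ notation ∕ set_option`; standard axioms.
[cite: Balaban1985Variational, Thm 1 p.279, Prop. 5 p.294, Prop. 6 p.295, Prop. 7 p.299, (26)–(27) p.282, (45)–(47) p.285, (74)–(84) pp.289–290, (100)–(111) pp.293–294; Balaban1985BackgroundPropagators, (3.119) p.419, (3.124)–(3.128) pp.420–421, (3.134) p.422; Balaban1987RG1, (0.21) p.256]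
-/

noncomputable section

open Set Metric Filter Topology
open scoped Matrix Matrix.Norms.L2Operator InnerProductSpace ComplexConjugate

namespace Summit.QuantumFields.YangMills.Theorems.N07KnitTokensLandauTwoOfRows

open Literature.MathematicalPhysics.QuantumFieldTheory.Balaban1983to89
open Literature.MathematicalPhysics.QuantumFieldTheory.Balaban1983to89.T4Continuum (T4Family)
open Literature.MathematicalPhysics.QuantumFieldTheory.Balaban1983to89.Node00
open B9Eq311TracePairing (starW)
open B11Eq103H1Complex (SiteL2K BondL2K readFun funEquiv QFun covDivL2K)
open B11Eq111FrakG (nabla115)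
open B11Eq115Space (NegSize NegSup JetSup)
open B11Eq174Chart (Regime)
open Summit.QuantumFields.YangMills.Theorems.N07TraceSectorDefs (scalPartW)
open B11Prop6Scheme (Prop4Hyp mapT)
open B11Eq90Transpose (pair27)
open B11Eq90V0primeCurrent (flat115)
open B11Eq90V0GroupComposed (T47)
open B11Eq80Current (Emap quadPart)
open B11Eq80CurrentZpow (V80Z)
open B9Eq3119DeltaPiCarrier (currentCLM)
open Summit.QuantumFields.YangMills.Theorems.N07Row84OfEq81AtRecord (hasDerivAt_re_inner_affine hasDerivAt_re_inner_quad_affine hasDerivAt_re_V80Z_line inner_iota_eq_pair27)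
open Summit.QuantumFields.YangMills.Theorems.N07KnitTokensLandauTwo (knitTokens_landau_two_of_row84)
open Summit.QuantumFields.YangMills.Theorems.N07KnitTokensLandauTwoOfEq81 (hessOpOfRecord128_symm_of_hessSymmTok)
open Summit.QuantumFields.YangMills.Theorems.N07Eq81OfEq26AtRecord (eq81_of_eq26_along_chart)

/-! ## §1  (81) ⟹ (84), slice-restricted -/

section Record

variable (F : T4Family) (N : ℕ) [NeZero N] {K : ℕ} (k : ℕ) (Ω : ℕ → Set (Site (F.P K) 0)) (U₀ : GaugeField (F.P K) 0 (SU N))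
  [Fact (0 < (F.L : ℝ))] [Fact (0 < (F.P K).eta k)] (levB : PBond (F.P K) k → ℕ) [Fact (0 < c0Rec F K k)] [Fact (∀ c, 0 < wBRec F K k c)] (a : ℝ)
  (hposb : ∀ x, x ≠ 0 → 0 < RCLike.re ⟪x, laplaceAOfRecord F N k U₀ (QOfRecord F N k U₀) (QflatOfRecord F N k) a x⟫_ℂ)
  (hQ : Function.Surjective (QOfRecord F N k U₀)) (εC : ℝ)
  (Gp : SiteL2K ℂ (F.P K).d (fun _ => (F.P K).sitesPerDir 0) (c0Rec F K k) (WRec N) →ₗ[ℂ]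
    SiteL2K ℂ (F.P K).d (fun _ => (F.P K).sitesPerDir 0) (c0Rec F K k) (WRec N))
  (Δ2 : BondL2K ℂ (F.P K).d (fun _ => (F.P K).sitesPerDir 0) (c0Rec F K k) (WRec N) →ₗ[ℂ]
    BondL2K ℂ (F.P K).d (fun _ => (F.P K).sitesPerDir 0) (c0Rec F K k) (WRec N))
  (hposπ : ∀ x, x ≠ 0 → 0 < RCLike.re ⟪x, laplaceAOfRecordAt F N k U₀ (hessOpOfRecord128 F N k U₀ Gp (QflatOfRecord F N k) Δ2)
    (QOfRecord F N k U₀) (QflatOfRecord F N k) a x⟫_ℂ)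
  {b C₂ c₄ aC : ℝ}
  (RC : Regime (H1OfRecordAtBgFlat F N K k Ω U₀ levB a hposb hQ) 0 (CslOfRecord F N K k Ω U₀ levB) b 0 C₂ c₄ 0 aC εC)
  (hC : Prop4Hyp (CslOfRecord F N K k Ω U₀ levB) C₂ c₄)
  (ι : Space115Lit F N K k Ω U₀ ≃ₗ[ℂ] BondL2K ℂ (F.P K).d (fun _ => (F.P K).sitesPerDir 0) (c0Rec F K k) (WRec N))
  (hι : ∀ y, ι y = (funEquiv (phiRec N) (fun _ : B9SectCLatticeCarrier.Bond (F.P K).d (fun _ => (F.P K).sitesPerDir 0) => c0Rec F K k)).symm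
    (JetSup.equiv _ _ (nabla115 ((F.P K).eta k) (unitsOfRecord F N U₀)) y))

omit [NeZero N] [Fact (0 < (F.L : ℝ))] [Fact (0 < (F.P K).eta k)] [Fact (∀ c, 0 < wBRec F K k c)] in
/-- **`π` FIXES THE LANDAU KERNEL** `RD*X = 0` (read on `L²`: `R_r D†(ιX) = 0`), for ANY `G′` — the CORRECT row for `A′`-side objects (RR-2 READ 23: `A′ = 𝒜 + H₁B` lives on the affine slice (77)∩(76),
not in (102) = `ker Q ⊓ ker RD*`; `π = 1 − DG′R_rD†` reads the Landau conjunct only). [cite: Balaban1985BackgroundPropagators, (3.119) p.419; Balaban1985Variational, (76) p.289] -/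
theorem piOfRecord_iota_of_landau {X : Space115Lit F N K k Ω U₀} (hX : RrOfRecord F N k U₀ (QflatOfRecord F N k) (covDivL2K ℂ (c0Rec F K k) (cRec F K k) (SRec F N U₀) (ι X)) = 0) :
    piOfRecord F N k U₀ Gp (QflatOfRecord F N k) (ι X) = ι X := by
  simp only [piOfRecord, LinearMap.sub_apply, LinearMap.id_apply, LinearMap.comp_apply]
  rw [hX, map_zero, map_zero, sub_zero]

include hι in
omit [NeZero N] [Fact (0 < (F.L : ℝ))] [Fact (0 < (F.P K).eta k)] [Fact (∀ c, 0 < wBRec F K k c)] in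
/-- The slice (102) lies in the Landau kernel (its second conjunct, ✓`mem_constraint102_iff`). [cite: Balaban1985Variational, (102) p.293, (76) p.289] -/
theorem landau_of_mem_constraint102 {δ : Space115Lit F N K k Ω U₀} (hδ : δ ∈ constraint102OfRecord F N K k Ω U₀) : RrOfRecord F N k U₀ (QflatOfRecord F N k) (covDivL2K ℂ (c0Rec F K k) (cRec F K k) (SRec F N U₀) (ι δ)) = 0 := by
  obtain ⟨-, hRδ⟩ := (B11Eq111FrakG.mem_constraint102_iff _ _ _ _ _ δ).1 hδ
  rw [hι]; exact hRδ

include hι in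
/-- ★★★ **(74) ⟹ (81) AT THE RECORD WITH THE `π`-ROWS AS LANDAU ROWS** — the CORRECTLY TYPED companion of ✓`eq81_of_eq26_along_chart_of_mem` (whose (102)-memberships over-strengthen: RR-2 READ 23):
`RD*A′ = 0` and `RD*HD(A′) = 0` (read on `L²`), i.e. print's (76) and (45)'s second row — true for `H_π`; for `H₁♭` the second is the F-H row. [cite: Balaban1985Variational, (74)–(81) pp.289–290, (45) p.285, (76) p.289] -/
theorem eq81_of_eq26_along_chart_of_landau {𝒳 : Type*} [NormedAddCommGroup 𝒳] [NormedSpace ℂ 𝒳] (H : 𝒳 →L[ℂ] Space115Lit F N K k Ω U₀) (C : Space115Lit F N K k Ω U₀ → 𝒳) (εT : ℝ)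
    (dom : Set (GaugeField (F.P K) k (SU N))) (B₀ C₄ a₃ j a𝔄 ε₄ : ℝ) (V : GaugeField (F.P K) k (SU N)) (A : Space115Lit F N K k Ω U₀)
    (hA : ∀ b, star (JetSup.equiv _ _ (nabla115 ((F.P K).eta k) (unitsOfRecord F N U₀)) (A + frakAOfRecordAtBg128 F N K k Ω U₀ levB Gp Δ2 a hposπ hQ V) b) =
      JetSup.equiv _ _ (nabla115 ((F.P K).eta k) (unitsOfRecord F N U₀)) (A + frakAOfRecordAtBg128 F N K k Ω U₀ levB Gp Δ2 a hposπ hQ V) b)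
    (hX : ∀ b, star (JetSup.equiv _ _ (nabla115 ((F.P K).eta k) (unitsOfRecord F N U₀)) (T47 H C εT (A + frakAOfRecordAtBg128 F N K k Ω U₀ levB Gp Δ2 a hposπ hQ V)) b) =
      JetSup.equiv _ _ (nabla115 ((F.P K).eta k) (unitsOfRecord F N U₀)) (T47 H C εT (A + frakAOfRecordAtBg128 F N K k Ω U₀ levB Gp Δ2 a hposπ hQ V)) b)
    (htrX : ∀ b, Matrix.trace (JetSup.equiv _ _ (nabla115 ((F.P K).eta k) (unitsOfRecord F N U₀)) (T47 H C εT (A + frakAOfRecordAtBg128 F N K k Ω U₀ levB Gp Δ2 a hposπ hQ V)) b) = 0)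
    (hAL : RrOfRecord F N k U₀ (QflatOfRecord F N k) (covDivL2K ℂ (c0Rec F K k) (cRec F K k) (SRec F N U₀) (ι (A + frakAOfRecordAtBg128 F N K k Ω U₀ levB Gp Δ2 a hposπ hQ V))) = 0)
    (hEL : RrOfRecord F N k U₀ (QflatOfRecord F N k) (covDivL2K ℂ (c0Rec F K k) (cRec F K k) (SRec F N U₀) (ι (Emap H C εT (A + frakAOfRecordAtBg128 F N K k Ω U₀ levB Gp Δ2 a hposπ hQ V)))) = 0)
    (hΔ2 : pair27 (tauRecCLM N)
        (currentCLM (phiRec N) (pairLevLit F Ω k) (nabla115 ((F.P K).eta k) (unitsOfRecord F N U₀)) Δ2 (A + frakAOfRecordAtBg128 F N K k Ω U₀ levB Gp Δ2 a hposπ hQ V))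
        (flat115 (A + frakAOfRecordAtBg128 F N K k Ω U₀ levB Gp Δ2 a hposπ hQ V)) =
      -2 * pair27 (tauRecCLM N) (JOfRecordAtBg F N K k Ω U₀) (flat115 (H (quadPart C (A + frakAOfRecordAtBg128 F N K k Ω U₀ levB Gp Δ2 a hposπ hQ V))))) :
    wilsonAction4 ((bgSchemeOfRecord F N K k Ω U₀ dom levB Gp Δ2 a hposπ hposb hQ εC B₀ C₄ a₃ j a𝔄 ε₄).chartLin (fun _ => T47 H C εT) V A) =
      wilsonAction4 U₀ + (N : ℝ)⁻¹ *
        (RCLike.re ⟪ι (A + frakAOfRecordAtBg128 F N K k Ω U₀ levB Gp Δ2 a hposπ hQ V),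
            (funEquiv (phiRec N) (fun _ : B9SectCLatticeCarrier.Bond (F.P K).d (fun _ => (F.P K).sitesPerDir 0) => c0Rec F K k)).symm (NegSup.equiv _ _ (JOfRecordAtBg F N K k Ω U₀))⟫_ℂ +
          2⁻¹ * RCLike.re ⟪ι (A + frakAOfRecordAtBg128 F N K k Ω U₀ levB Gp Δ2 a hposπ hQ V),
            hessOpOfRecord128 F N k U₀ Gp (QflatOfRecord F N k) Δ2 (ι (A + frakAOfRecordAtBg128 F N K k Ω U₀ levB Gp Δ2 a hposπ hQ V))⟫_ℂ +
          RCLike.re (V80Z (tauRecCLM N) (unitsOfRecord F N U₀) H C εT (JOfRecordAtBg F N K k Ω U₀) (DeltaPiCurOfRecord F N K k Ω U₀ Gp (QflatOfRecord F N k))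
            (A + frakAOfRecordAtBg128 F N K k Ω U₀ levB Gp Δ2 a hposπ hQ V))) :=
  N07Eq81OfEq26AtRecord.eq81_of_eq26_along_chart F N k Ω U₀ levB a hposb hQ εC Gp Δ2 hposπ ι hι H C εT dom B₀ C₄ a₃ j a𝔄 ε₄ V A hA hX htrX
    (piOfRecord_iota_of_landau F N k Ω U₀ Gp ι hAL) (piOfRecord_iota_of_landau F N k Ω U₀ Gp ι hEL) hΔ2

include hι RC hC in
/-- ★★★ **(81) ⟹ (84) AT THE RECORD, LANDAU-RESTRICTED EDITION** (the VALUE row asked only on `evHerm0 ∩ {RD*A′ = 0}`, where (81) is print's; extra displayed row `RD*𝔄V = 0`, read on `L²`).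
ORIGINAL DOCSTRING of ✓`row84_of_eq81`:  At the frame-free scheme of record (slot (c), any `N`, any slot `T`) fix `V`, a radius `ρ₁ ≤ a_C`, and suppose: the VALUE identity (81) on the
real slice ball — for every `A′ ∈ evHerm0` with `‖A′‖ < ρ₁`, `A^η(S.chartLin T V (A′ − 𝔄V)) = a₀ + c·(ℜ⟪ιA′, Ĵ⟫ + ½ℜ⟪ιA′, Δ₁ ιA′⟫ + ℜ V80Z(A′))` (`Δ₁ = π†(Δ(U₀) + Δ⁽²⁾)π`,
`V80Z` at `WOfRecordAt`'s slots) — and `Δ₁` symmetric.  THEN the (84)-row of ✓`minTokens_ofRecord_landau_of_row84` holds at every `A` of the Landau family `Kc^L_ρ V` (`ρ ≤ ρ₁`) and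
every real tangent direction `δ ∈ (102) ∩ evHerm0`: `HasDerivAt (t ↦ A^η(S.chartLin T V (A + t•δ))) (c·ℜ(⟪ιδ, Ĵ⟫ + ⟪ιδ, Δ₁ ι(A+𝔄V)⟫ + ⟪ιδ, (W(A+𝔄V))^⟫)) 0`.
[cite: Balaban1985Variational, (81)–(84) p.290, (63) p.287, (27) p.282] -/
theorem row84_of_eq81_slice (hsym : ∀ x y, ⟪hessOpOfRecord128 F N k U₀ Gp (QflatOfRecord F N k) Δ2 x, y⟫_ℂ = ⟪x, hessOpOfRecord128 F N k U₀ Gp (QflatOfRecord F N k) Δ2 y⟫_ℂ)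
    (dom : Set (GaugeField (F.P K) k (SU N))) (B₀ C₄ a₃ j a𝔄 ε₄ : ℝ)
    (T : GaugeField (F.P K) k (SU N) → Space115Lit F N K k Ω U₀ → Space115Lit F N K k Ω U₀) (V : GaugeField (F.P K) k (SU N))
    {ρ ρ₁ : ℝ} (hρ : ρ ≤ ρ₁) (hρ₁ : ρ₁ ≤ aC) (a₀ c : ℝ)
    (h𝔄 : RrOfRecord F N k U₀ (QflatOfRecord F N k) (covDivL2K ℂ (c0Rec F K k) (cRec F K k) (SRec F N U₀) (ι (frakAOfRecordAtBg128 F N K k Ω U₀ levB Gp Δ2 a hposπ hQ V))) = 0)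
    (eq81 : ∀ A' : Space115Lit F N K k Ω U₀,
      A' ∈ (bgSchemeOfRecord F N K k Ω U₀ dom levB Gp Δ2 a hposπ hposb hQ εC B₀ C₄ a₃ j a𝔄 ε₄).evHerm0 →
      RrOfRecord F N k U₀ (QflatOfRecord F N k) (covDivL2K ℂ (c0Rec F K k) (cRec F K k) (SRec F N U₀) (ι A')) = 0 → ‖A'‖ < ρ₁ →
      wilsonAction4 ((bgSchemeOfRecord F N K k Ω U₀ dom levB Gp Δ2 a hposπ hposb hQ εC B₀ C₄ a₃ j a𝔄 ε₄).chartLin T V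
          (A' - frakAOfRecordAtBg128 F N K k Ω U₀ levB Gp Δ2 a hposπ hQ V)) =
        a₀ + c * (RCLike.re ⟪ι A', (funEquiv (phiRec N) (fun _ : B9SectCLatticeCarrier.Bond (F.P K).d (fun _ => (F.P K).sitesPerDir 0) => c0Rec F K k)).symm
            (NegSup.equiv _ _ (JOfRecordAtBg F N K k Ω U₀))⟫_ℂ +
          2⁻¹ * RCLike.re ⟪ι A', hessOpOfRecord128 F N k U₀ Gp (QflatOfRecord F N k) Δ2 (ι A')⟫_ℂ +
          RCLike.re (B11Eq80CurrentZpow.V80Z (tauRecCLM N) (unitsOfRecord F N U₀) (H1OfRecordAtBgFlat F N K k Ω U₀ levB a hposb hQ)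
            (CslOfRecord F N K k Ω U₀ levB) εC (JOfRecordAtBg F N K k Ω U₀) (DeltaPiCurOfRecord F N K k Ω U₀ Gp (QflatOfRecord F N k)) A'))) :
    ∀ A ∈ {A : Space115Lit F N K k Ω U₀ | A ∈ constraint102OfRecord F N K k Ω U₀ ∧
        A + frakAOfRecordAtBg128 F N K k Ω U₀ levB Gp Δ2 a hposπ hQ V ∈ (bgSchemeOfRecord F N K k Ω U₀ dom levB Gp Δ2 a hposπ hposb hQ εC B₀ C₄ a₃ j a𝔄 ε₄).evHerm0 ∧
        ‖A + frakAOfRecordAtBg128 F N K k Ω U₀ levB Gp Δ2 a hposπ hQ V‖ < ρ},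
      ∀ δ ∈ {δ : Space115Lit F N K k Ω U₀ | δ ∈ constraint102OfRecord F N K k Ω U₀ ∧
        δ ∈ (bgSchemeOfRecord F N K k Ω U₀ dom levB Gp Δ2 a hposπ hposb hQ εC B₀ C₄ a₃ j a𝔄 ε₄).evHerm0},
      HasDerivAt (fun t : ℝ => wilsonAction4 ((bgSchemeOfRecord F N K k Ω U₀ dom levB Gp Δ2 a hposπ hposb hQ εC B₀ C₄ a₃ j a𝔄 ε₄).chartLin T V (A + t • δ)))
        (c * RCLike.re
          (⟪ι δ, (funEquiv (phiRec N) (fun _ : B9SectCLatticeCarrier.Bond (F.P K).d (fun _ => (F.P K).sitesPerDir 0) => c0Rec F K k)).symm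
              (NegSup.equiv _ _ (JOfRecordAtBg F N K k Ω U₀))⟫_ℂ +
            ⟪ι δ, hessOpOfRecord128 F N k U₀ Gp (QflatOfRecord F N k) Δ2 (ι (A + frakAOfRecordAtBg128 F N K k Ω U₀ levB Gp Δ2 a hposπ hQ V))⟫_ℂ +
            ⟪ι δ, (funEquiv (phiRec N) (fun _ : B9SectCLatticeCarrier.Bond (F.P K).d (fun _ => (F.P K).sitesPerDir 0) => c0Rec F K k)).symm
              (NegSup.equiv _ _ (WOfRecordAt F N K k Ω U₀ levB a hposb hQ εC Gp (A + frakAOfRecordAtBg128 F N K k Ω U₀ levB Gp Δ2 a hposπ hQ V)))⟫_ℂ)) 0 := by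
  intro A hA δ hδ
  obtain ⟨hA102, hAherm, hAlt⟩ := hA
  obtain ⟨hδ102, hδherm⟩ := hδ
  set A' := A + frakAOfRecordAtBg128 F N K k Ω U₀ levB Gp Δ2 a hposπ hQ V with hA'def
  have hA'aC : ‖A'‖ < aC := lt_of_lt_of_le hAlt (hρ.trans hρ₁)
  -- δ is Hermitian-presented
  have hδstar : ∀ bb, star (JetSup.equiv _ _ (nabla115 ((F.P K).eta k) (unitsOfRecord F N U₀)) δ bb) =
      JetSup.equiv _ _ (nabla115 ((F.P K).eta k) (unitsOfRecord F N U₀)) δ bb :=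
    (N07LieTokAtOfRecordTwo.conjJet_eq_self_iff F N K k Ω U₀ δ).1
      ((N07LieTokAtOfRecordTwo.mem_evHerm0_ofRecord_iff F N K k Ω U₀ dom levB Gp Δ2 a hposπ hposb hQ εC B₀ C₄ a₃ j a𝔄 ε₄ δ).1 hδherm).1
  -- (81) holds along the line for small real t
  have hnhds : {t : ℝ | ‖A' + (t : ℂ) • δ‖ < ρ₁} ∈ 𝓝 (0 : ℝ) := by
    refine IsOpen.mem_nhds ?_ ?_
    · exact isOpen_lt ((continuous_const.add (Complex.continuous_ofReal.smul continuous_const)).norm) continuous_const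
    · show ‖A' + ((0 : ℝ) : ℂ) • δ‖ < ρ₁
      simpa using lt_of_lt_of_le hAlt hρ
  have hEq : (fun t : ℝ => wilsonAction4 ((bgSchemeOfRecord F N K k Ω U₀ dom levB Gp Δ2 a hposπ hposb hQ εC B₀ C₄ a₃ j a𝔄 ε₄).chartLin T V (A + t • δ))) =ᶠ[𝓝 0]
      fun t : ℝ => a₀ + c * (RCLike.re ⟪ι (A' + (t : ℂ) • δ), (funEquiv (phiRec N) (fun _ : B9SectCLatticeCarrier.Bond (F.P K).d (fun _ => (F.P K).sitesPerDir 0) => c0Rec F K k)).symm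
            (NegSup.equiv _ _ (JOfRecordAtBg F N K k Ω U₀))⟫_ℂ +
          2⁻¹ * RCLike.re ⟪ι (A' + (t : ℂ) • δ), hessOpOfRecord128 F N k U₀ Gp (QflatOfRecord F N k) Δ2 (ι (A' + (t : ℂ) • δ))⟫_ℂ +
          RCLike.re (B11Eq80CurrentZpow.V80Z (tauRecCLM N) (unitsOfRecord F N U₀) (H1OfRecordAtBgFlat F N K k Ω U₀ levB a hposb hQ)
            (CslOfRecord F N K k Ω U₀ levB) εC (JOfRecordAtBg F N K k Ω U₀) (DeltaPiCurOfRecord F N K k Ω U₀ Gp (QflatOfRecord F N k)) (A' + (t : ℂ) • δ))) := by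
    filter_upwards [hnhds] with t ht
    have hmem : A' + (t : ℂ) • δ ∈ (bgSchemeOfRecord F N K k Ω U₀ dom levB Gp Δ2 a hposπ hposb hQ εC B₀ C₄ a₃ j a𝔄 ε₄).evHerm0 := by
      rw [Complex.coe_smul]; exact add_mem hAherm (Submodule.smul_mem _ t hδherm)
    have hLA := landau_of_mem_constraint102 F N k Ω U₀ ι hι hA102
    have hLδ := landau_of_mem_constraint102 F N k Ω U₀ ι hι hδ102
    have hmemL : RrOfRecord F N k U₀ (QflatOfRecord F N k) (covDivL2K ℂ (c0Rec F K k) (cRec F K k) (SRec F N U₀) (ι (A' + (t : ℂ) • δ))) = 0 := by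
      simp only [hA'def, map_add, map_smul, hLA, h𝔄, hLδ, smul_zero, add_zero]
    have h81 := eq81 _ hmem hmemL ht
    have hsub : A' + (t : ℂ) • δ - frakAOfRecordAtBg128 F N K k Ω U₀ levB Gp Δ2 a hposπ hQ V = A + t • δ := by
      rw [hA'def, Complex.coe_smul]; abel
    rw [hsub] at h81
    exact h81
  -- derivative of the right-hand side
  have hlin : ∀ t : ℝ, ι (A' + (t : ℂ) • δ) = ι A' + (t : ℂ) • ι δ := fun t => by rw [map_add, map_smul]
  have hJ := hasDerivAt_re_inner_affine (ι A') (ι δ)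
    ((funEquiv (phiRec N) (fun _ : B9SectCLatticeCarrier.Bond (F.P K).d (fun _ => (F.P K).sitesPerDir 0) => c0Rec F K k)).symm (NegSup.equiv _ _ (JOfRecordAtBg F N K k Ω U₀)))
  have hQd := hasDerivAt_re_inner_quad_affine (hessOpOfRecord128 F N k U₀ Gp (QflatOfRecord F N k) Δ2) hsym (ι A') (ι δ)
  have hV := hasDerivAt_re_V80Z_line F N k Ω U₀ levB a hposb hQ εC Gp RC hC hA'aC δ
  have hsum := ((hJ.add (hQd.const_mul (2⁻¹ : ℝ))).add hV).const_mul c |>.const_add a₀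
  have hsum' : HasDerivAt (fun t : ℝ => a₀ + c * (RCLike.re ⟪ι (A' + (t : ℂ) • δ), (funEquiv (phiRec N) (fun _ : B9SectCLatticeCarrier.Bond (F.P K).d (fun _ => (F.P K).sitesPerDir 0) => c0Rec F K k)).symm
            (NegSup.equiv _ _ (JOfRecordAtBg F N K k Ω U₀))⟫_ℂ +
          2⁻¹ * RCLike.re ⟪ι (A' + (t : ℂ) • δ), hessOpOfRecord128 F N k U₀ Gp (QflatOfRecord F N k) Δ2 (ι (A' + (t : ℂ) • δ))⟫_ℂ +
          RCLike.re (B11Eq80CurrentZpow.V80Z (tauRecCLM N) (unitsOfRecord F N U₀) (H1OfRecordAtBgFlat F N K k Ω U₀ levB a hposb hQ)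
            (CslOfRecord F N K k Ω U₀ levB) εC (JOfRecordAtBg F N K k Ω U₀) (DeltaPiCurOfRecord F N K k Ω U₀ Gp (QflatOfRecord F N k)) (A' + (t : ℂ) • δ))))
      (c * (RCLike.re ⟪ι δ, (funEquiv (phiRec N) (fun _ : B9SectCLatticeCarrier.Bond (F.P K).d (fun _ => (F.P K).sitesPerDir 0) => c0Rec F K k)).symm (NegSup.equiv _ _ (JOfRecordAtBg F N K k Ω U₀))⟫_ℂ +
        2⁻¹ * (2 * RCLike.re ⟪ι δ, hessOpOfRecord128 F N k U₀ Gp (QflatOfRecord F N k) Δ2 (ι A')⟫_ℂ) +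
        RCLike.re (pair27 (tauRecCLM N) (WOfRecordAt F N K k Ω U₀ levB a hposb hQ εC Gp A') (flat115 δ)))) 0 := by
    refine hsum.congr_of_eventuallyEq (Filter.Eventually.of_forall fun t => ?_)
    simp only [hlin, Pi.add_apply]
  -- the pairing identification for the `W`-term and the assembly
  have hW := inner_iota_eq_pair27 F N k Ω U₀ ι hι hδstar (WOfRecordAt F N K k Ω U₀ levB a hposb hQ εC Gp A')
  refine (hsum'.congr_of_eventuallyEq hEq).congr_deriv ?_
  simp only [RCLike.re_to_complex, Complex.add_re]
  rw [hW]
  ring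

end Record

/-! ## §2  The knit chain at `N = 2`, closed up to named rows -/

section Two

variable (F : T4Family) {K : ℕ} (k : ℕ) (Ω : ℕ → Set (Site (F.P K) 0)) (U₀ : GaugeField (F.P K) 0 (SU 2))
  [Fact (0 < (F.L : ℝ))] [Fact (0 < (F.P K).eta k)] (levB : PBond (F.P K) k → ℕ) [Fact (0 < c0Rec F K k)] [Fact (∀ c, 0 < wBRec F K k c)] (a : ℝ)
  (hposb : ∀ x, x ≠ 0 → 0 < RCLike.re ⟪x, laplaceAOfRecord F 2 k U₀ (QOfRecord F 2 k U₀) (QflatOfRecord F 2 k) a x⟫_ℂ)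
  (hQ : Function.Surjective (QOfRecord F 2 k U₀)) {b C₂ c₄ aC εC : ℝ}
  (RC : Regime (H1OfRecordAtBgFlat F 2 K k Ω U₀ levB a hposb hQ) 0 (CslOfRecord F 2 K k Ω U₀ levB) b 0 C₂ c₄ 0 aC εC)
  (hCreal : ∀ A : Space115Lit F 2 K k Ω U₀,
    ((JetSup.equiv _ _ (nabla115 ((F.P K).eta k) (unitsOfRecord F 2 U₀))).symm
        (star (JetSup.equiv _ _ (nabla115 ((F.P K).eta k) (unitsOfRecord F 2 U₀)) A)) : Space115Lit F 2 K k Ω U₀) = A →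
    ‖A‖ ≤ εC + aC → ((NegSup.equiv _ _).symm (star (NegSup.equiv _ _ (CslOfRecord F 2 K k Ω U₀ levB A))) :
      NegSize (F.L : ℝ) ((F.P K).eta k) levB 0 (Matrix (Fin 2) (Fin 2) ℂ)) = CslOfRecord F 2 K k Ω U₀ levB A)
  (hCtr : ∀ A : Space115Lit F 2 K k Ω U₀,
    ((JetSup.equiv _ _ (nabla115 ((F.P K).eta k) (unitsOfRecord F 2 U₀))).symm
        (star (JetSup.equiv _ _ (nabla115 ((F.P K).eta k) (unitsOfRecord F 2 U₀)) A)) : Space115Lit F 2 K k Ω U₀) = A →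
    (∀ b, (JetSup.equiv _ _ (nabla115 ((F.P K).eta k) (unitsOfRecord F 2 U₀)) A b).trace = 0) →
    ‖A‖ ≤ εC + aC → ∀ c, (NegSup.equiv _ _ (CslOfRecord F 2 K k Ω U₀ levB A) c).trace = 0)
  (Gp : SiteL2K ℂ (F.P K).d (fun _ => (F.P K).sitesPerDir 0) (c0Rec F K k) (WRec 2) →ₗ[ℂ]
    SiteL2K ℂ (F.P K).d (fun _ => (F.P K).sitesPerDir 0) (c0Rec F K k) (WRec 2))
  (Δ2 : BondL2K ℂ (F.P K).d (fun _ => (F.P K).sitesPerDir 0) (c0Rec F K k) (WRec 2) →ₗ[ℂ]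
    BondL2K ℂ (F.P K).d (fun _ => (F.P K).sitesPerDir 0) (c0Rec F K k) (WRec 2))
  (hposπ : ∀ x, x ≠ 0 → 0 < RCLike.re ⟪x, laplaceAOfRecordAt F 2 k U₀ (hessOpOfRecord128 F 2 k U₀ Gp (QflatOfRecord F 2 k) Δ2)
    (QOfRecord F 2 k U₀) (QflatOfRecord F 2 k) a x⟫_ℂ)

include RC hCreal hCtr in
/-- ★★★ **THE FOUR KNIT TOKENS AT `N = 2` FOR THE LANDAU FAMILY, FROM NAMED ROWS ONLY** — no expansion identity displayed: (rng) ∧ (star_mem) ∧ (min) ∧ (c→s) at the (47)-carrying chart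
`𝔖♭.chartLin T♭` for `Kc^L_ρ`, from file 4's Sect. C ∕ standard ∕ numeric rows + def-Y's `HessSymmTok` and `Delta2Tok` VERBATIM + `𝔄V ∈ (102)` + reality∕trace of `T47 A′` on the slice ball +
**THE F-H ROW** «`RD*(Emap H₁♭ C^{sl} ε_C A′) = 0` for `A′ ∈ evHerm0`, `RD*A′ = 0`, `‖A′‖ < ρ₀`» (print's (45) 2nd row ∘ (76) for the chart's `H`; FALSE for `H₁♭` off the flat locus per RR-2's flag —
then this theorem is vacuous there; it becomes print's statement under def-Y's re-key `H₁♭ ↦ H_π`).  Chain: LANDED-4 ∘ §1 ∘ LANDED-9 (`a₀ = A^η(U₀)`, `c = N⁻¹ = ½`).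
[cite: Balaban1985Variational, Thm 1 p.279, Prop. 5 p.294, Prop. 6 p.295, Prop. 7 p.299, (45)–(47) p.285, (74)–(84) pp.289–290, (100)–(111) pp.293–294; Balaban1985BackgroundPropagators, (3.124)–(3.128) pp.420–421, (3.134) p.422] -/
theorem knitTokens_landau_two_of_rows (h : SmallBelow (avOfRecord F 2 K) k U₀) {ε : ℝ} (hU₀reg : U₀ ∈ bgReg F 2 K k ε)
    (hC : Prop4Hyp (CslOfRecord F 2 K k Ω U₀ levB) C₂ c₄) (haC : 0 < aC)
    (ι : Space115Lit F 2 K k Ω U₀ ≃ₗ[ℂ] BondL2K ℂ (F.P K).d (fun _ => (F.P K).sitesPerDir 0) (c0Rec F K k) (WRec 2))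
    (hι : ∀ y, ι y = (funEquiv (phiRec 2) (fun _ : B9SectCLatticeCarrier.Bond (F.P K).d (fun _ => (F.P K).sitesPerDir 0) => c0Rec F K k)).symm
      (JetSup.equiv _ _ (nabla115 ((F.P K).eta k) (unitsOfRecord F 2 U₀)) y))
    (hsym : HessSymmTok F 2 K k U₀ Δ2) (hΔ2 : Delta2Tok F 2 K k Ω U₀ levB a hposb hQ Δ2) :
    ∃ ρ₀ M γ : ℝ, 0 < ρ₀ ∧ ρ₀ ≤ aC ∧ 0 ≤ M ∧ 0 < γ ∧
      ∀ (dom : Set (GaugeField (F.P K) k (SU 2))) (B₀ C₄ a₃ j a𝔄 ε₄ ρ : ℝ)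
        (S : BgSchemeOnLit F 2 K k Ω U₀) (_hS : S = bgSchemeOfRecord F 2 K k Ω U₀ dom levB Gp Δ2 a hposπ hposb hQ εC B₀ C₄ a₃ j a𝔄 ε₄),
        ρ ≤ ρ₀ → ε₄ + a𝔄 ≤ ρ → 2 * (ρ + a𝔄 + a𝔄) ≤ a₃ → 4 * M * B₀ * C₄ * (ρ + a𝔄 + a𝔄) < γ →
        dom ⊆ logDiscOfRecord F 2 K k U₀ → S.RegimeTok → FrakGSliceTok F 2 K k Ω U₀ Gp Δ2 a hposπ hQ → (∀ V ∈ dom, S.LieTokAt V) →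
        -- the Landau row of `𝔄V = H₁B(V)`: `RD*𝔄V = 0` (print's (45) 2nd row for the slot-(c) `H₁`; read on `L²`)
        (∀ V ∈ dom, RrOfRecord F 2 k U₀ (QflatOfRecord F 2 k) (covDivL2K ℂ (c0Rec F K k) (cRec F K k) (SRec F 2 U₀) (ι (S.𝔄 V))) = 0) →
        -- reality ∕ trace rows of `T47 A′` on the slice ball (✓`conjJet_T47_eq`, ✓`trace_equiv_T47_eq_zero` under the section's rows)
        (∀ A' : Space115Lit F 2 K k Ω U₀, A' ∈ S.evHerm0 → RrOfRecord F 2 k U₀ (QflatOfRecord F 2 k) (covDivL2K ℂ (c0Rec F K k) (cRec F K k) (SRec F 2 U₀) (ι A')) = 0 → ‖A'‖ < ρ₀ →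
          (∀ b', star (JetSup.equiv _ _ (nabla115 ((F.P K).eta k) (unitsOfRecord F 2 U₀))
              (T47 (H1OfRecordAtBgFlat F 2 K k Ω U₀ levB a hposb hQ) (CslOfRecord F 2 K k Ω U₀ levB) εC A') b') =
            JetSup.equiv _ _ (nabla115 ((F.P K).eta k) (unitsOfRecord F 2 U₀))
              (T47 (H1OfRecordAtBgFlat F 2 K k Ω U₀ levB a hposb hQ) (CslOfRecord F 2 K k Ω U₀ levB) εC A') b') ∧
          (∀ b', Matrix.trace (JetSup.equiv _ _ (nabla115 ((F.P K).eta k) (unitsOfRecord F 2 U₀))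
              (T47 (H1OfRecordAtBgFlat F 2 K k Ω U₀ levB a hposb hQ) (CslOfRecord F 2 K k Ω U₀ levB) εC A') b') = 0)) →
        -- THE F-H ROW: `RD*(H₁♭ D(A′)) = 0` on the Landau ball (print's (45) 2nd row ∘ (76); NOT a theorem for `H₁♭` off the flat locus — RR-2's TRACE FLAG F-H)
        (∀ A' : Space115Lit F 2 K k Ω U₀, A' ∈ S.evHerm0 → RrOfRecord F 2 k U₀ (QflatOfRecord F 2 k) (covDivL2K ℂ (c0Rec F K k) (cRec F K k) (SRec F 2 U₀) (ι A')) = 0 → ‖A'‖ < ρ₀ →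
          RrOfRecord F 2 k U₀ (QflatOfRecord F 2 k) (covDivL2K ℂ (c0Rec F K k) (cRec F K k) (SRec F 2 U₀) (ι (Emap (H1OfRecordAtBgFlat F 2 K k Ω U₀ levB a hposb hQ) (CslOfRecord F 2 K k Ω U₀ levB) εC A'))) = 0) →
        -- (rng)
        (∀ V ∈ S.dom, ∀ A ∈ {A : Space115Lit F 2 K k Ω U₀ | A ∈ constraint102OfRecord F 2 K k Ω U₀ ∧ A + S.𝔄 V ∈ S.evHerm0 ∧ ‖A + S.𝔄 V‖ < ρ},
          S.chartLin (fun _ => T47 (H1OfRecordAtBgFlat F 2 K k Ω U₀ levB a hposb hQ) (CslOfRecord F 2 K k Ω U₀ levB) εC) V A ∈ bgReg F 2 K k ε ∧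
          Averaging.iter (avOfRecord F 2 K) k
            (S.chartLin (fun _ => T47 (H1OfRecordAtBgFlat F 2 K k Ω U₀ levB a hposb hQ) (CslOfRecord F 2 K k Ω U₀ levB) εC) V A) = V) ∧
        -- (star_mem)
        (∀ V ∈ S.dom, S.sol V ∈ {A : Space115Lit F 2 K k Ω U₀ | A ∈ constraint102OfRecord F 2 K k Ω U₀ ∧ A + S.𝔄 V ∈ S.evHerm0 ∧ ‖A + S.𝔄 V‖ < ρ}) ∧
        -- (min)
        (∀ V ∈ S.dom, IsMinOn (wilsonAction4 ∘ S.chartLin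
              (fun _ => T47 (H1OfRecordAtBgFlat F 2 K k Ω U₀ levB a hposb hQ) (CslOfRecord F 2 K k Ω U₀ levB) εC) V)
            {A : Space115Lit F 2 K k Ω U₀ | A ∈ constraint102OfRecord F 2 K k Ω U₀ ∧ A + S.𝔄 V ∈ S.evHerm0 ∧ ‖A + S.𝔄 V‖ < ρ} (S.sol V)) ∧
        -- (c→s)
        (∀ V ∈ S.dom, ∀ A ∈ {A : Space115Lit F 2 K k Ω U₀ | A ∈ constraint102OfRecord F 2 K k Ω U₀ ∧ A + S.𝔄 V ∈ S.evHerm0 ∧ ‖A + S.𝔄 V‖ < ρ},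
          IsMinOn (wilsonAction4 ∘ S.chartLin
              (fun _ => T47 (H1OfRecordAtBgFlat F 2 K k Ω U₀ levB a hposb hQ) (CslOfRecord F 2 K k Ω U₀ levB) εC) V)
            {A : Space115Lit F 2 K k Ω U₀ | A ∈ constraint102OfRecord F 2 K k Ω U₀ ∧ A + S.𝔄 V ∈ S.evHerm0 ∧ ‖A + S.𝔄 V‖ < ρ} A →
          ‖A‖ ≤ S.ε₄ ∧ mapT (S.𝒢 V) 0 (S.W V) (S.J V) (S.𝔄 V) A = A) := by
  have hc : (0 : ℝ) < ((2 : ℕ) : ℝ)⁻¹ := by positivity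
  obtain ⟨ρ₀, M, γ, hρ₀, hρ₀aC, hM, hγ, hmain⟩ :=
    knitTokens_landau_two_of_row84 F k Ω U₀ levB a hposb hQ RC hCreal hCtr Gp Δ2 hposπ h hU₀reg hC haC _ hc ι hι
  refine ⟨ρ₀, M, γ, hρ₀, hρ₀aC, hM, hγ, ?_⟩
  intro dom B₀ C₄ a₃ j a𝔄 ε₄ ρ S hS hρ hfit hdom hnum hdisc hR h𝔊 hL h𝔄L hT47 hFH
  refine hmain dom B₀ C₄ a₃ j a𝔄 ε₄ ρ S hS hρ hfit hdom hnum hdisc hR h𝔊 hL ?_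
  intro V hV A hA δ hδ
  subst hS
  -- the (81) VALUE row on the slice ball, from LANDED-9 at `H := H₁♭`
  have eq81 : ∀ A' : Space115Lit F 2 K k Ω U₀,
      A' ∈ (bgSchemeOfRecord F 2 K k Ω U₀ dom levB Gp Δ2 a hposπ hposb hQ εC B₀ C₄ a₃ j a𝔄 ε₄).evHerm0 →
      RrOfRecord F 2 k U₀ (QflatOfRecord F 2 k) (covDivL2K ℂ (c0Rec F K k) (cRec F K k) (SRec F 2 U₀) (ι A')) = 0 → ‖A'‖ < ρ₀ →
      wilsonAction4 ((bgSchemeOfRecord F 2 K k Ω U₀ dom levB Gp Δ2 a hposπ hposb hQ εC B₀ C₄ a₃ j a𝔄 ε₄).chartLin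
          (fun _ => T47 (H1OfRecordAtBgFlat F 2 K k Ω U₀ levB a hposb hQ) (CslOfRecord F 2 K k Ω U₀ levB) εC) V
          (A' - frakAOfRecordAtBg128 F 2 K k Ω U₀ levB Gp Δ2 a hposπ hQ V)) =
        wilsonAction4 U₀ + ((2 : ℕ) : ℝ)⁻¹ * (RCLike.re ⟪ι A', (funEquiv (phiRec 2) (fun _ : B9SectCLatticeCarrier.Bond (F.P K).d (fun _ => (F.P K).sitesPerDir 0) => c0Rec F K k)).symm
            (NegSup.equiv _ _ (JOfRecordAtBg F 2 K k Ω U₀))⟫_ℂ +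
          2⁻¹ * RCLike.re ⟪ι A', hessOpOfRecord128 F 2 k U₀ Gp (QflatOfRecord F 2 k) Δ2 (ι A')⟫_ℂ +
          RCLike.re (B11Eq80CurrentZpow.V80Z (tauRecCLM 2) (unitsOfRecord F 2 U₀) (H1OfRecordAtBgFlat F 2 K k Ω U₀ levB a hposb hQ)
            (CslOfRecord F 2 K k Ω U₀ levB) εC (JOfRecordAtBg F 2 K k Ω U₀) (DeltaPiCurOfRecord F 2 K k Ω U₀ Gp (QflatOfRecord F 2 k)) A')) := by
    intro A' hh hL' hlt
    obtain ⟨hXr, hXt⟩ := hT47 A' hh hL' hlt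
    have hA'r : ∀ bb, star (JetSup.equiv _ _ (nabla115 ((F.P K).eta k) (unitsOfRecord F 2 U₀)) A' bb) =
        JetSup.equiv _ _ (nabla115 ((F.P K).eta k) (unitsOfRecord F 2 U₀)) A' bb :=
      (N07LieTokAtOfRecordTwo.conjJet_eq_self_iff F 2 K k Ω U₀ A').1
        ((N07LieTokAtOfRecordTwo.mem_evHerm0_ofRecord_iff F 2 K k Ω U₀ dom levB Gp Δ2 a hposπ hposb hQ εC B₀ C₄ a₃ j a𝔄 ε₄ A').1 hh).1
    have h := eq81_of_eq26_along_chart_of_landau F 2 k Ω U₀ levB a hposb hQ εC Gp Δ2 hposπ ι hι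
      (H1OfRecordAtBgFlat F 2 K k Ω U₀ levB a hposb hQ) (CslOfRecord F 2 K k Ω U₀ levB) εC dom B₀ C₄ a₃ j a𝔄 ε₄ V
      (A' - frakAOfRecordAtBg128 F 2 K k Ω U₀ levB Gp Δ2 a hposπ hQ V)
      (by simpa only [sub_add_cancel] using hA'r) (by simpa only [sub_add_cancel] using hXr) (by simpa only [sub_add_cancel] using hXt)
      (by simpa only [sub_add_cancel] using hL') (by simpa only [sub_add_cancel] using hFH A' hh hL' hlt)
      (by simpa only [sub_add_cancel] using hΔ2 A')
    simpa only [sub_add_cancel] using h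
  have h84 := row84_of_eq81_slice F 2 k Ω U₀ levB a hposb hQ εC Gp Δ2 hposπ RC hC ι hι
    (hessOpOfRecord128_symm_of_hessSymmTok F 2 k U₀ Gp (QflatOfRecord F 2 k) hsym) dom B₀ C₄ a₃ j a𝔄 ε₄
    (fun _ => T47 (H1OfRecordAtBgFlat F 2 K k Ω U₀ levB a hposb hQ) (CslOfRecord F 2 K k Ω U₀ levB) εC) V hρ hρ₀aC (wilsonAction4 U₀) (((2 : ℕ) : ℝ)⁻¹)
    (by simpa only [bgSchemeOfRecord_𝔄] using h𝔄L V hV) eq81 A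
    (by simpa only [bgSchemeOfRecord_𝔄] using hA) δ hδ
  simpa only [bgSchemeOfRecord_J, bgSchemeOfRecord_W, bgSchemeOfRecord_𝔄] using h84

end Two

end Summit.QuantumFields.YangMills.Theorems.N07KnitTokensLandauTwoOfRows

end
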